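import Summits.ResolutionOfSingularities.ResolutionOfSingularities.Theorems.PurelyInseparableDim4ResConeCInfEntryAt
import Summits.ResolutionOfSingularities.ResolutionOfSingularities.Theorems.PurelyInseparableDim4SwapTransportWindowResidual
import HarnessLib
import HarnessLib.Audit.Tags

/-!
# Purely inseparable four-folds — THE C∞ CONFIGURATION IS IMPOSSIBLE: the entry `hE` from the chain, the killer with
# rotations, and the K24b-R1 re-presentation residual `hN4` AS A THEOREM (K24b-R1 (E0) packaging, part 2)
# (cell `res-dim4-pi`, K2(p) lane, slice B; hN4 discharge)

[OURS · counted 0 · cell `res-dim4-pi` · K2(p) lane; the lane holder's word (bus 2026-08-29 06:20:38Z) and crit-4 g5's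
§K-A4-122/123; seat res-dim4-p-3 g4 over res-dim4-typ-1 g3's K24b-R1 window (`SwapTransport.cInf_no_chain_of_entry`,
p702286).]  Nothing here proves K2(p)/K2(5), `NoIsolatedTrap 5 5` or resolution of singularities in dimension ≥ 4 /
characteristic `p` — NOT proved.  AI kernel work, weaker than expert review.

* **`cInf_hE_of_chain`** — the ENTRY HYPOTHESIS `hE` of typ-1's `cInf_no_chain_of_entry`, VERBATIM, from the chain binders
  of the C∞ regime (witnessed isolated `Step0 5` chain, `x^{r₀} ∣ F₀`, above the floor, shade `≡ 4`, `e_G ≡ 3`, weights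
  `≤ 1` of total `2` from `k₀`, slots born from `k₁ ≥ k₀`): beyond every index a time `k` with letters `λ μ u f`, a
  bijection `π₀`, `(c k).r = e_{π₀λ} + e_{π₀μ}` and for all `M N` a framed virtual partner — `cInf_entry_at` at `k − 1`.
* **`cInf_no_chain`** — the C∞ configuration (with rotations) carries NO such chain: typ-1's window ∘ `cInf_hE_of_chain`.
* **`cInf_slotRepresentation`** — res-dim4-p-3 g4's K24b-R1 residual `hN4` of K27c/K27d
  (`…ResConeKTwoFiveLedger(N4)`), character for character, now a THEOREM (vacuously: the binder block is contradictory).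

[cite: CossartJannsenSaito2020, Thm. 3.14, Lemma 13.2] [cite: Hauser2010, §§F–G]
bears_on: LADDER-RESOLUTION:D157-DOOR2 (res-dim4-pi · K2(p) slice B · hN4 DISCHARGED).
Supports stmt-ResolutionOfSingularities-16155 (helper).
-/

set_option linter.dupNamespace false -- mandated namespace of this single-conjunct summit

noncomputable section

namespace Summit.ResolutionOfSingularities.ResolutionOfSingularities.Theorems.PIDim4

namespace ResCone

open MvPolynomial Finset
open Literature.AlgebraicGeometry.Resolution
open Literature.AlgebraicGeometry.Resolution.CentreBlowup
open Literature.AlgebraicGeometry.Resolution.Hauser2010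
open Literature.AlgebraicGeometry.Resolution.HauserPerlega2019

section Chain

variable {K : Type} [Field K] [CharP K 5] [DecidableEq K]

/-- **THE ENTRY `hE` FROM THE CHAIN** (module docstring). [OURS] [cite: CossartJannsenSaito2020, Thm. 3.14, Lemma 13.2] -/
theorem cInf_hE_of_chain {c : ℕ → State K} {j : ℕ → Fin 4} {b : ℕ → Fin 4 → K}
    (hc : ∀ k, IsIsolated 5 (c k).F ∧ Step0 5 (c k) (c (k + 1))) (hw : FreeTail.IsWitnessedChain 5 c j b)
    (hr0 : ∀ e ∈ (c 0).F.support, (c 0).r ≤ e) (hfloor : ∀ k, ordZero (c k).F ≠ (5 : ℕ)) {k₀ : ℕ}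
    (hshade : ∀ k, k₀ ≤ k → (c k).shade = ((4 : ℕ) : ℕ∞))
    (he3 : ∀ k, k₀ ≤ k → Module.finrank K (resVertex (c k)) = 3) {k₁ : ℕ} (hk₁ : k₀ ≤ k₁)
    (hwt : ∀ k, k₀ ≤ k → (∀ i, (c k).r i ≤ 1) ∧ (c k).r.degree = 2)
    (hborn : ∀ k, k₁ ≤ k → ∀ i, 1 ≤ (c k).r i →
      ∃ t, k₀ ≤ t ∧ t < k ∧ j t = i ∧ ∀ m, t < m → m < k → j m ≠ i ∧ b m i = 0) :
    ∀ k₂, ∃ k, k₂ ≤ k ∧ ∃ (la mu u f : Fin 4) (π₀ : Equiv.Perm (Fin 4)),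
      la ≠ mu ∧ la ≠ u ∧ la ≠ f ∧ mu ≠ u ∧ mu ≠ f ∧ u ≠ f ∧
      (c k).r = Finsupp.single (π₀ la) 1 + Finsupp.single (π₀ mu) 1 ∧
      ∀ M N : ℕ, ∃ B₀ : State K,
        (∃ (θ e : Fin 4 → MvPolynomial (Fin 4) K) (U E : MvPolynomial (Fin 4) K),
          θ (π₀ la) = X la * e la ∧ θ (π₀ mu) = X mu * e mu ∧ constantCoeff (e la) ≠ 0 ∧ constantCoeff (e mu) ≠ 0 ∧
          constantCoeff (θ (π₀ u)) = 0 ∧ constantCoeff (θ (π₀ f)) = 0 ∧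
          coeff (Finsupp.single u 1) (θ (π₀ u)) * coeff (Finsupp.single f 1) (θ (π₀ f)) -
            coeff (Finsupp.single f 1) (θ (π₀ u)) * coeff (Finsupp.single u 1) (θ (π₀ f)) ≠ 0 ∧
          constantCoeff U ≠ 0 ∧ E ∈ originIdeal K ^ M ∧ B₀.F = deletePthPowers 5 (U ^ 5 * aeval θ (c k).F) + E) ∧
        ordZero B₀.F = 6 ∧ B₀.r = Finsupp.single la 1 + Finsupp.single mu 1 ∧ (∀ d ∈ B₀.F.support, B₀.r ≤ d) ∧
        (∃ a : K, a ≠ 0 ∧ resForm B₀ = C a * X f ^ 4) ∧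
        (∀ e ∈ B₀.F.support, e f ≤ 3 → 2 ≤ e la ∧ 2 ≤ e mu) ∧
        (∀ d ∈ B₀.F.support, d.degree < N → ¬ (d u = 2 ∧ d f = 0)) ∧
        coeff (B₀.r + (Finsupp.single la 1 + Finsupp.single mu 1 + Finsupp.single u 3)) B₀.F ≠ 0 ∧
        IsIsolated 5 B₀.F ∧ Module.finrank K (resVertex B₀) = 3 := by
  intro k₂
  obtain ⟨la, mu, u, f, π₀, hlm, hlu, hlf, hmu, hmf, huf, hr, hinner⟩ :=
    cInf_entry_at hc hw hr0 hfloor hshade he3 hk₁ hwt hborn (k' := max k₂ (k₁ + 1))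
      ((Nat.le_succ k₁).trans (le_max_right _ _)) (le_trans (by omega) (le_max_right _ _))
  exact ⟨max k₂ (k₁ + 1) + 1, (le_max_left _ _).trans (Nat.le_succ _), la, mu, u, f, π₀, hlm, hlu, hlf, hmu, hmf, huf, hr,
    hinner⟩

/-- **THE C∞ CONFIGURATION (rotations allowed) IS IMPOSSIBLE**: no witnessed isolated above-floor `Step0 5` chain with
`x^{r₀} ∣ F₀`, shade `≡ 4`, `e_G ≡ 3`, weights `≤ 1` of total `2`, slots born — res-dim4-typ-1 g3's virtual window
`SwapTransport.cInf_no_chain_of_entry` fed with `cInf_hE_of_chain`. [OURS] [cite: CossartJannsenSaito2020, Thm. 3.14] -/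
theorem cInf_no_chain {c : ℕ → State K} {j : ℕ → Fin 4} {b : ℕ → Fin 4 → K}
    (hc : ∀ k, IsIsolated 5 (c k).F ∧ Step0 5 (c k) (c (k + 1))) (hw : FreeTail.IsWitnessedChain 5 c j b)
    (hr0 : ∀ e ∈ (c 0).F.support, (c 0).r ≤ e) (hfloor : ∀ k, ordZero (c k).F ≠ (5 : ℕ)) {k₀ : ℕ}
    (hshade : ∀ k, k₀ ≤ k → (c k).shade = ((4 : ℕ) : ℕ∞))
    (he3 : ∀ k, k₀ ≤ k → Module.finrank K (resVertex (c k)) = 3) {k₁ : ℕ} (hk₁ : k₀ ≤ k₁)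
    (hwt : ∀ k, k₀ ≤ k → (∀ i, (c k).r i ≤ 1) ∧ (c k).r.degree = 2)
    (hborn : ∀ k, k₁ ≤ k → ∀ i, 1 ≤ (c k).r i →
      ∃ t, k₀ ≤ t ∧ t < k ∧ j t = i ∧ ∀ m, t < m → m < k → j m ≠ i ∧ b m i = 0) : False :=
  SwapTransport.cInf_no_chain_of_entry hc hw hr0 hfloor hshade he3 hwt (cInf_hE_of_chain hc hw hr0 hfloor hshade he3 hk₁ hwt hborn)

end Chain

/-- **THE K24b-R1 RE-PRESENTATION RESIDUAL `hN4` IS A THEOREM** — the binder of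
`noAboveFloorTrap_five_iff_sliceC_of_N4` / `…_of_rotation`, character for character (vacuously, by `cInf_no_chain`). [OURS]
[cite: CossartJannsenSaito2020, Thm. 3.14] -/
theorem cInf_slotRepresentation :
    ∀ (K : Type) [Field K] [CharP K 5] [DecidableEq K] (c : ℕ → State K) (j : ℕ → Fin 4)
      (b : ℕ → Fin 4 → K), (∀ k, IsIsolated 5 (c k).F ∧ Step0 5 (c k) (c (k + 1))) →
      FreeTail.IsWitnessedChain 5 c j b → (∀ e ∈ (c 0).F.support, (c 0).r ≤ e) →
      (∀ k, ordZero (c k).F ≠ (5 : ℕ)) → ∀ k₀ : ℕ, (∀ k, k₀ ≤ k → (c k).shade = ((4 : ℕ) : ℕ∞)) →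
      (∀ k, k₀ ≤ k → Module.finrank K (resVertex (c k)) = 3) →
      ∀ k₁ : ℕ, k₀ ≤ k₁ → (∀ k, k₀ ≤ k → (∀ i, (c k).r i ≤ 1) ∧ (c k).r.degree = 2) →
      (∀ k, k₁ ≤ k → ∀ i, 1 ≤ (c k).r i →
        ∃ t, k₀ ≤ t ∧ t < k ∧ j t = i ∧ ∀ m, t < m → m < k → j m ≠ i ∧ b m i = 0) →
      ∃ (c' : ℕ → State K) (j' : ℕ → Fin 4) (b' : ℕ → Fin 4 → K) (k₀' k₁' : ℕ),
        (∀ k, IsIsolated 5 (c' k).F ∧ Step0 5 (c' k) (c' (k + 1))) ∧ FreeTail.IsWitnessedChain 5 c' j' b' ∧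
        (∀ e ∈ (c' 0).F.support, (c' 0).r ≤ e) ∧ (∀ k, ordZero (c' k).F ≠ (5 : ℕ)) ∧
        (∀ k, k₀' ≤ k → (c' k).shade = ((4 : ℕ) : ℕ∞)) ∧
        (∀ k, k₀' ≤ k → Module.finrank K (resVertex (c' k)) = 3) ∧ k₀' ≤ k₁' ∧
        (∀ k, k₀' ≤ k → (∀ i, (c' k).r i ≤ 1) ∧ (c' k).r.degree = 2) ∧
        (∀ k, k₁' ≤ k → ∀ i, 1 ≤ (c' k).r i →
          ∃ t, k₀' ≤ t ∧ t < k ∧ j' t = i ∧ ∀ m, t < m → m < k → j' m ≠ i ∧ b' m i = 0) ∧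
        (∀ k, k₁' ≤ k → 1 ≤ (c' k).r (j' k)) :=
  fun _ _ _ _ _ _ _ hc hw hr0 hfloor _ hshade he3 _ hk₁ hwt hborn =>
    (cInf_no_chain hc hw hr0 hfloor hshade he3 hk₁ hwt hborn).elim

end ResCone

end Summit.ResolutionOfSingularities.ResolutionOfSingularities.Theorems.PIDim4

end
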